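import Summits.QuantumFields.YangMills.Theorems.BalabanUVNodesN15TwoGridBoxAvg
import Summits.QuantumFields.YangMills.Theorems.BalabanUVNodesN15NeumannCubeDivergence
import HarnessLib

/-!
# N15 (NE2) — PROGRAMME M «MEAN-ZERO MULTIPLIERS», part M-A: CELL LINES, LINE MEANS, LINE ANTIDERIVATIVES; THE EXACT DIVERGENCE FORM OF A LINE-MEAN-ZERO
# MULTIPLIER BEHIND KING's PROLONGATION

WHO ∕ WHEN.  Cell `pub-ymgap`, seat `pub-ymgap-dag-n15-a` (KNIT-BY-NAME seat of Track-A DAG node N15 = NE2, g24); `--kind proof --supports stmt-QuantumFields-27366 --as helper` (K3⁸;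
count-neutral).  Over part 70 `…TwoGridBoxAvg` (`boxPt`, `boxPt_val`, `blockOf_boxPt`, `boxPt_rem`, `box_digits_lt`), parts 34∕35 (`symbOp`, `kingPr_val`, `sTinv`), N-IId `…NeumannCubeDivergence` (`symbOp_divAdj_apply`) BY NAME; nothing modified.
WHY.  [B9] Thm 3.1 asks of the background only (3.35) (cube gauge: `|A| ≤ O(1)Mα₀(L^jη)^{−1}`, `|∇^ηA| ≤ O(1)Mα₀(L^jη)^{−2}`, p. 396).  The ZEROTH-ORDER coefficient of `Δ_U − Δ`
((3.52): `c ≈ −∇*·a + O(a²)`; the lineage's `tCoefC`, n15-w3 `curvCoefC_eq_cancel`) is then BOUNDED with NO modulus of continuity: a POINTWISE two-grid fit `|c′ − c̄∘π| ≤ o`, `o` a rate, is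
NOT available from (3.35) — the lineage's fit letters for it (`FibreOsc`, `hfitC`, `coeffBgC2`'s `|∇′c′|`) are (3.36)-strength, as n15-b ∕ n15-c ∕ n15-w2 say (INBOX l.40662 «PAIRING DATA, not
producible from (3.35) of one grid»).  The η-rate survives WITHOUT regularity of the multiplier: the cell-oscillating part of a bounded fine multiplier is an EXACT fine divergence of LINE
ANTIDERIVATIVES of size `(cell side ∕ η′-steps)·sup = L^{−k}·sup`, and King's prolongation `P` is constant on cells, so the divergence passes to the left of `M_{·}∘P` exactly; behind an
operator with a SOURCE-DIVERGENCE letter ((1.110) ∕ (3.42) entry 2 «G∇*») it costs one rate factor.  This file = the one-direction device; the sweep over directions + block majorants = M-B.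
WHAT ([folklore] finite-lattice algebra; four plumbing `def`s).  Fine torus `Tor (fine n M)`, cells = side-`ℓ` sub-boxes of the unit blocks (`ℓ ∣ n`).  §1 `cellOff`, `linePt κ x j` (the
`j`-th point of `x`'s `κ`-line: `boxPt` with one offset replaced): `boxPt_boxPt`, `cellOff_boxPt`, `linePt_cellOff`, `linePt_linePt`, `cellOff_linePt_self∕_ne`, `blockOf_linePt`, ★ `kingPr_boxPt`
∕ `kingPr_linePt` (`n = L^mL^k`, `ℓ = L^m`: the pairing is constant on cells), `cellOff_add_unitVec` (a step raises the offset or resets it at a face), `linePt_pred_eq_sub_unitVec`,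
`cellOff_sub_unitVec_of_eq_zero`, `kingPr_sub_unitVec_of_ne_zero`.  §2 linear maps `lineMean ℓ κ` (`ℓ⁻¹Σ_{j<ℓ} g(linePt κ x j, a)`), `linePrim ℓ κ` (`n⁻¹Σ_{j ≤ off_κ x} g(linePt κ x j, a)`,
lattice factor `n⁻¹ = η`): `lineMean_linePt`, `lineMean_lineMean` (idempotent), `abs_lineMean_le`, ★ `abs_linePrim_le` (`≤ (ℓ∕n)·sup` = THE RATE `L^{−k}`), the one-step values of `linePrim`.
§3 ★ `divAdj_linePrim_apply` (`∇*_κ linePrim_κ g = −g + 1_{off_κ=0}·ℓ·(lineMean_κ g)(·−e_κ)`), ★★ `divAdj_mulOp_linePrim_pull_apply` (the same behind `M_{·}∘P`, `P = pull (kingPrV L k m M)`),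
★★★ `mulOp_comp_pull_eq_neg_divAdj_of_lineMean` (`lineMean_κ g = 0 ⟹ M_g∘P = −ρ′(n′(s_κ⁻¹−1))∘M_{linePrim_κ g}∘P` EXACTLY), `eq_neg_divAdj_linePrim_of_lineMean` (one grid).
HONEST FRAMING ∕ LIMITS.  Lattice bookkeeping on the `U ≡ 1` torus MODEL carriers (King's pairing, unit blocks); no estimate of [B5]∕[B6]∕[B9] used or asserted; NE2⁺ NOT printed ∕ proved; no
statement of record touched — a (3.36)-free MECHANISM to replace a displayed pointwise fit in the MODEL knits; N15 NOT discharged; K3⁸ OPEN; counts UNMOVED (typed 28∕28 · discharged 5∕27);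
one finite torus pair per index — NOT infinite volume ∕ OS ∕ mass gap ∕ Clay.
-/


open scoped BigOperators
open Finset

namespace Summit.QuantumFields.YangMills.BalabanUVNodes.N15.TwoGrid

open Literature.MathematicalPhysics.QuantumFieldTheory.Balaban1983to89
open Literature.MathematicalPhysics.QuantumFieldTheory.Balaban1983to89.T4EtaRateCoeffDefect (pull pull_apply)
open Literature.MathematicalPhysics.QuantumFieldTheory.Balaban1983to89.B6Prop26Gluing (mulOp mulOp_apply)
open Literature.MathematicalPhysics.QuantumFieldTheory.Balaban1983to89.B5Prop11Plancherel (Tor fine unitVec)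
open Literature.MathematicalPhysics.QuantumFieldTheory.King1986.Torus (blockOf val_blockOf)
open Summit.QuantumFields.YangMills.BalabanUVNodes.N15.VectorPiece (kingPr kingPrV kingPr_val kingPrV_eq)

variable {d : ℕ}
/-! ## §1 Cells of side `ℓ`, their `κ`-lines, offsets; one lattice step; King's pairing is constant on cells -/

section Cells

variable (M : Fin (d + 1) → ℕ) [∀ μ, NeZero (M μ)] (n : ℕ) [NeZero n] (ℓ : ℕ)

/-- the OFFSET VECTOR of a fine point inside its side-`ℓ` cell: `off_i(x) = (x_i mod n) mod ℓ` (part 70's `boxPt_rem` offsets). [folklore] -/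
def cellOff (x : Tor (fine n M)) : Fin (d + 1) → ℕ := fun i => ((x i).val % n) % ℓ

/-- the `j`-th point of the `κ`-LINE of `x` inside its cell: all offsets of `x` kept except `off_κ := j`. [folklore] -/
def linePt (κ : Fin (d + 1)) (x : Tor (fine n M)) (j : ℕ) : Tor (fine n M) := boxPt M n ℓ x (Function.update (cellOff M n ℓ x) κ j)

variable {ℓ}

omit [∀ μ, NeZero (M μ)] [NeZero n] in
/-- every offset is `< ℓ` (`0 < ℓ`). [folklore] -/
theorem cellOff_lt (hℓ : 0 < ℓ) (x : Tor (fine n M)) (i : Fin (d + 1)) : cellOff M n ℓ x i < ℓ := Nat.mod_lt _ hℓ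

/-- `boxPt` at the point's own offsets is the point (part 70 `boxPt_rem`). [folklore] -/
theorem boxPt_cellOff (x : Tor (fine n M)) : boxPt M n ℓ x (cellOff M n ℓ x) = x := boxPt_rem M n x

/-- the line point at the point's own `κ`-offset is the point. [folklore] -/
theorem linePt_cellOff (κ : Fin (d + 1)) (x : Tor (fine n M)) : linePt M n ℓ κ x (cellOff M n ℓ x κ) = x := by
  rw [linePt, Function.update_eq_self, boxPt_cellOff]

omit [∀ μ, NeZero (M μ)] [NeZero n] in
/-- `boxPt` is coordinatewise: coordinate `i` only sees `t i`. [folklore] -/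
theorem boxPt_apply_congr (x : Tor (fine n M)) {t t' : Fin (d + 1) → ℕ} {i : Fin (d + 1)} (h : t i = t' i) : boxPt M n ℓ x t i = boxPt M n ℓ x t' i := by
  simp only [boxPt, h]

omit [∀ μ, NeZero (M μ)] [NeZero n] in
/-- the digits of a coordinate: `v = n⌊v∕n⌋ + ℓ⌊(v mod n)∕ℓ⌋ + off`. [folklore] -/
theorem val_eq_digits (x : Tor (fine n M)) (i : Fin (d + 1)) : (x i).val = n * ((x i).val / n) + ℓ * (((x i).val % n) / ℓ) + cellOff M n ℓ x i := by
  rw [cellOff, add_assoc, Nat.div_add_mod, Nat.div_add_mod]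

/-- ITERATED SUB-BOX POINTS: the cell corner of `boxPt x t` is the cell corner of `x` (`ℓ ∣ n`, `t < ℓ`). [folklore] -/
theorem boxPt_boxPt (hℓn : ℓ ∣ n) (x : Tor (fine n M)) {t : Fin (d + 1) → ℕ} (ht : ∀ i, t i < ℓ) (t' : Fin (d + 1) → ℕ) :
    boxPt M n ℓ (boxPt M n ℓ x t) t' = boxPt M n ℓ x t' := by
  have hn0 : 0 < n := Nat.pos_of_ne_zero (NeZero.ne n)
  have hℓ0 : 0 < ℓ := Nat.pos_of_dvd_of_pos hℓn hn0
  funext i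
  have hv := boxPt_val M n hℓn x ht i
  have hq : (boxPt M n ℓ x t i).val / n = (x i).val / n := by
    rw [hv, add_assoc, Nat.mul_add_div hn0, Nat.div_eq_of_lt (box_digits_lt n hℓn (ht i)), add_zero]
  have hr : (boxPt M n ℓ x t i).val % n / ℓ = ((x i).val % n) / ℓ := by
    rw [hv, add_assoc, Nat.mul_add_mod, Nat.mod_eq_of_lt (box_digits_lt n hℓn (ht i)), Nat.mul_add_div hℓ0, Nat.div_eq_of_lt (ht i), add_zero]
  show ((n * ((boxPt M n ℓ x t i).val / n) + ℓ * (((boxPt M n ℓ x t i).val % n) / ℓ) + t' i : ℕ) : ZMod (fine n M i)) = _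
  rw [hq, hr]
  rfl

/-- the offsets of a sub-box point are its offset data (`ℓ ∣ n`, `t < ℓ`). [folklore] -/
theorem cellOff_boxPt (hℓn : ℓ ∣ n) (x : Tor (fine n M)) {t : Fin (d + 1) → ℕ} (ht : ∀ i, t i < ℓ) : cellOff M n ℓ (boxPt M n ℓ x t) = t := by
  funext i
  rw [cellOff, boxPt_val M n hℓn x ht i, add_assoc, Nat.mul_add_mod, Nat.mod_eq_of_lt (box_digits_lt n hℓn (ht i)), Nat.mul_add_mod, Nat.mod_eq_of_lt (ht i)]

omit [∀ μ, NeZero (M μ)] [NeZero n] in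
/-- offsets of an updated offset vector stay `< ℓ`. [folklore] -/
theorem update_cellOff_lt (hℓ : 0 < ℓ) (x : Tor (fine n M)) (κ : Fin (d + 1)) {j : ℕ} (hj : j < ℓ) (i : Fin (d + 1)) :
    Function.update (cellOff M n ℓ x) κ j i < ℓ := by
  rcases eq_or_ne i κ with rfl | h
  · rw [Function.update_self]; exact hj
  · rw [Function.update_of_ne h]; exact cellOff_lt M n hℓ x i

/-- points of one line share the line: `linePt κ (linePt κ x j) j′ = linePt κ x j′` (`j < ℓ`). [folklore] -/
theorem linePt_linePt (hℓn : ℓ ∣ n) (κ : Fin (d + 1)) (x : Tor (fine n M)) {j : ℕ} (hj : j < ℓ) (j' : ℕ) :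
    linePt M n ℓ κ (linePt M n ℓ κ x j) j' = linePt M n ℓ κ x j' := by
  have hℓ0 : 0 < ℓ := Nat.pos_of_dvd_of_pos hℓn (Nat.pos_of_ne_zero (NeZero.ne n))
  have ht := update_cellOff_lt M n hℓ0 x κ hj
  rw [linePt, linePt, cellOff_boxPt M n hℓn x ht, Function.update_idem, linePt, boxPt_boxPt M n hℓn x ht]

/-- the `κ`-offset of the `j`-th line point is `j` (`j < ℓ`). [folklore] -/
theorem cellOff_linePt_self (hℓn : ℓ ∣ n) (κ : Fin (d + 1)) (x : Tor (fine n M)) {j : ℕ} (hj : j < ℓ) : cellOff M n ℓ (linePt M n ℓ κ x j) κ = j := by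
  have hℓ0 : 0 < ℓ := Nat.pos_of_dvd_of_pos hℓn (Nat.pos_of_ne_zero (NeZero.ne n))
  rw [linePt, cellOff_boxPt M n hℓn x (update_cellOff_lt M n hℓ0 x κ hj), Function.update_self]

/-- the other offsets of a line point are those of `x`. [folklore] -/
theorem cellOff_linePt_ne (hℓn : ℓ ∣ n) (κ : Fin (d + 1)) (x : Tor (fine n M)) {j : ℕ} (hj : j < ℓ) {i : Fin (d + 1)} (hi : i ≠ κ) :
    cellOff M n ℓ (linePt M n ℓ κ x j) i = cellOff M n ℓ x i := by
  have hℓ0 : 0 < ℓ := Nat.pos_of_dvd_of_pos hℓn (Nat.pos_of_ne_zero (NeZero.ne n))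
  rw [linePt, cellOff_boxPt M n hℓn x (update_cellOff_lt M n hℓ0 x κ hj), Function.update_of_ne hi]

/-- line points lie in the same UNIT block (part 70 `blockOf_boxPt`). [folklore] -/
theorem blockOf_linePt (hℓn : ℓ ∣ n) (κ : Fin (d + 1)) (x : Tor (fine n M)) {j : ℕ} (hj : j < ℓ) : blockOf n M (linePt M n ℓ κ x j) = blockOf n M x := by
  have hℓ0 : 0 < ℓ := Nat.pos_of_dvd_of_pos hℓn (Nat.pos_of_ne_zero (NeZero.ne n))
  exact blockOf_boxPt M n hℓn x (update_cellOff_lt M n hℓ0 x κ hj)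

/-- coordinates off the line's direction are those of `x`. [folklore] -/
theorem linePt_apply_ne (κ : Fin (d + 1)) (x : Tor (fine n M)) (j : ℕ) {i : Fin (d + 1)} (hi : i ≠ κ) : linePt M n ℓ κ x j i = x i := by
  rw [linePt, boxPt_apply_congr M n x (Function.update_of_ne hi _ _)]
  exact congrFun (boxPt_cellOff M n x) i

omit [∀ μ, NeZero (M μ)] [NeZero n] in
/-- the line's coordinate of the `j`-th line point, as a residue: `n⌊v∕n⌋ + ℓ⌊(v mod n)∕ℓ⌋ + j`. [folklore] -/
theorem linePt_apply_self (κ : Fin (d + 1)) (x : Tor (fine n M)) (j : ℕ) :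
    linePt M n ℓ κ x j κ = ((n * ((x κ).val / n) + ℓ * (((x κ).val % n) / ℓ) + j : ℕ) : ZMod (fine n M κ)) := by
  rw [linePt, boxPt, Function.update_self]

/-- **ONE LATTICE STEP AND THE OFFSET** (`ℓ ∣ n`): `off_κ(z + e_κ) = 0` if the step crosses a cell face (`ℓ ∣ z_κ + 1`), `= off_κ z + 1` otherwise; the other offsets are unchanged.
[cite: King1986, p.664 (blocks as floors; pairing convention)] -/
theorem cellOff_add_unitVec (hℓn : ℓ ∣ n) (z : Tor (fine n M)) (κ : Fin (d + 1)) :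
    cellOff M n ℓ (z + unitVec (fine n M) κ) κ = if ℓ ∣ (z κ).val + 1 then 0 else cellOff M n ℓ z κ + 1 := by
  have hn0 : 0 < n := Nat.pos_of_ne_zero (NeZero.ne n)
  have hℓ0 : 0 < ℓ := Nat.pos_of_dvd_of_pos hℓn hn0
  have hℓN : ℓ ∣ fine n M κ := hℓn.trans (Dvd.intro (M κ) rfl)
  have hval : ((z + unitVec (fine n M) κ) κ).val = ((z κ).val + 1) % fine n M κ := by
    rw [show (z + unitVec (fine n M) κ) κ = z κ + 1 by simp [unitVec], ZMod.val_add, ZMod.val_one_eq_one_mod, Nat.add_mod_mod]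
  have hmod : cellOff M n ℓ (z + unitVec (fine n M) κ) κ = ((z κ).val + 1) % ℓ := by
    rw [cellOff, hval, Nat.mod_mod_of_dvd _ hℓn, Nat.mod_mod_of_dvd _ hℓN]
  have hz : cellOff M n ℓ z κ = (z κ).val % ℓ := by rw [cellOff, Nat.mod_mod_of_dvd _ hℓn]
  rw [hmod, hz]
  split_ifs with hdvd
  · exact Nat.mod_eq_zero_of_dvd hdvd
  · have hlt : (z κ).val % ℓ + 1 < ℓ := by
      rcases Nat.lt_or_ge ((z κ).val % ℓ + 1) ℓ with h | h
      · exact h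
      · exfalso
        have heq : (z κ).val % ℓ + 1 = ℓ := le_antisymm (Nat.mod_lt _ hℓ0) h
        refine hdvd ⟨(z κ).val / ℓ + 1, ?_⟩
        calc (z κ).val + 1 = ℓ * ((z κ).val / ℓ) + (z κ).val % ℓ + 1 := by rw [Nat.div_add_mod]
          _ = ℓ * ((z κ).val / ℓ) + ((z κ).val % ℓ + 1) := by rw [Nat.add_assoc]
          _ = ℓ * ((z κ).val / ℓ) + ℓ := by rw [heq]
          _ = ℓ * ((z κ).val / ℓ + 1) := by rw [Nat.mul_add, Nat.mul_one]
    have hℓ1 : ℓ ≠ 1 := by omega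
    rw [Nat.add_mod, Nat.one_mod_eq_one.mpr hℓ1, Nat.mod_eq_of_lt hlt]

/-- **ONE STEP BACK INSIDE THE CELL**: if `off_κ x ≠ 0`, then `x − e_κ` is the line point of offset `off_κ x − 1`. [folklore] -/
theorem linePt_pred_eq_sub_unitVec (κ : Fin (d + 1)) (x : Tor (fine n M)) (h : cellOff M n ℓ x κ ≠ 0) :
    linePt M n ℓ κ x (cellOff M n ℓ x κ - 1) = x - unitVec (fine n M) κ := by
  funext i
  rcases eq_or_ne i κ with rfl | hi
  · rw [linePt_apply_self, show (x - unitVec (fine n M) i) i = x i - 1 by simp [unitVec]]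
    have hv := val_eq_digits M n (ℓ := ℓ) x i
    have h1 : 1 ≤ (x i).val := by rw [hv]; omega
    have e : n * ((x i).val / n) + ℓ * (((x i).val % n) / ℓ) + (cellOff M n ℓ x i - 1) = (x i).val - 1 := by omega
    rw [e, Nat.cast_sub h1, Nat.cast_one, ZMod.natCast_zmod_val]
  · rw [linePt_apply_ne M n κ x _ hi, show (x - unitVec (fine n M) κ) i = x i by simp [unitVec, hi]]

/-- **ONE STEP BACK ACROSS A FACE**: if `off_κ x = 0`, then `off_κ(x − e_κ) = ℓ − 1` (`ℓ ∣ n`). [folklore] -/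
theorem cellOff_sub_unitVec_of_eq_zero (hℓn : ℓ ∣ n) (κ : Fin (d + 1)) (x : Tor (fine n M)) (h : cellOff M n ℓ x κ = 0) :
    cellOff M n ℓ (x - unitVec (fine n M) κ) κ = ℓ - 1 := by
  have hn0 : 0 < n := Nat.pos_of_ne_zero (NeZero.ne n)
  have hℓ0 : 0 < ℓ := Nat.pos_of_dvd_of_pos hℓn hn0
  have hstep := cellOff_add_unitVec M n hℓn (x - unitVec (fine n M) κ) κ
  rw [sub_add_cancel, h] at hstep
  by_cases hdvd : ℓ ∣ ((x - unitVec (fine n M) κ) κ).val + 1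
  · have hz : cellOff M n ℓ (x - unitVec (fine n M) κ) κ = ((x - unitVec (fine n M) κ) κ).val % ℓ := by rw [cellOff, Nat.mod_mod_of_dvd _ hℓn]
    rw [hz]
    obtain ⟨c, hc⟩ := hdvd
    have hc1 : 1 ≤ c := by
      rcases c with _ | c
      · simp at hc
      · omega
    have : ((x - unitVec (fine n M) κ) κ).val = ℓ * (c - 1) + (ℓ - 1) := by
      have : ℓ * c = ℓ * (c - 1) + ℓ := by rw [← Nat.mul_succ, Nat.succ_eq_add_one, Nat.sub_add_cancel hc1]
      omega
    rw [this, Nat.mul_add_mod, Nat.mod_eq_of_lt (Nat.sub_lt hℓ0 Nat.one_pos)]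
  · rw [if_neg hdvd] at hstep
    exact absurd hstep.symm (Nat.succ_ne_zero _)

variable (L k m : ℕ) [NeZero L]

/-- ★ **KING's PAIRING IS CONSTANT ON CELLS**: with `n = L^m·L^k` and cells of side `ℓ = L^m`, `pr(boxPt x t) = pr x` for offsets `t < L^m`.
[cite: King1986, p.664 (pairing convention «x′ ∈ B^n(x)»)] -/
theorem kingPr_boxPt (x : Tor (fine (L ^ m * L ^ k) M)) {t : Fin (d + 1) → ℕ} (ht : ∀ i, t i < L ^ m) :
    kingPr L k m M (boxPt M (L ^ m * L ^ k) (L ^ m) x t) = kingPr L k m M x := by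
  have hℓ0 : 0 < L ^ m := pos_of_gt (lt_of_le_of_lt (Nat.zero_le _) (ht 0))
  have hℓn : L ^ m ∣ L ^ m * L ^ k := Dvd.intro _ rfl
  funext μ
  apply ZMod.val_injective
  rw [kingPr_val, kingPr_val, boxPt_val M (L ^ m * L ^ k) hℓn x ht μ]
  conv_rhs => rw [val_eq_digits M (L ^ m * L ^ k) (ℓ := L ^ m) x μ]
  have hr : cellOff M (L ^ m * L ^ k) (L ^ m) x μ < L ^ m := cellOff_lt M _ hℓ0 x μ
  have e : ∀ t : ℕ, L ^ m * L ^ k * ((x μ).val / (L ^ m * L ^ k)) + L ^ m * ((x μ).val % (L ^ m * L ^ k) / L ^ m) + t =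
      L ^ m * (L ^ k * ((x μ).val / (L ^ m * L ^ k)) + (x μ).val % (L ^ m * L ^ k) / L ^ m) + t := fun t => by ring
  rw [e, e, Nat.mul_add_div hℓ0, Nat.mul_add_div hℓ0, Nat.div_eq_of_lt (ht μ), Nat.div_eq_of_lt hr]

/-- King's pairing of a line point is that of the point (`j < L^m`). [cite: King1986, p.664 (pairing convention)] -/
theorem kingPr_linePt (κ : Fin (d + 1)) (x : Tor (fine (L ^ m * L ^ k) M)) {j : ℕ} (hj : j < L ^ m) :
    kingPr L k m M (linePt M (L ^ m * L ^ k) (L ^ m) κ x j) = kingPr L k m M x :=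
  kingPr_boxPt M L k m x (update_cellOff_lt M _ (pos_of_gt (lt_of_le_of_lt (Nat.zero_le _) hj)) x κ hj)

/-- ★ one step back INSIDE the cell does not change King's pairing: `off_κ x′ ≠ 0 ⟹ pr(x′ − e′_κ) = pr x′`. [cite: King1986, p.664 (pairing convention)] -/
theorem kingPr_sub_unitVec_of_ne_zero (κ : Fin (d + 1)) (x : Tor (fine (L ^ m * L ^ k) M)) (h : cellOff M (L ^ m * L ^ k) (L ^ m) x κ ≠ 0) :
    kingPr L k m M (x - unitVec (fine (L ^ m * L ^ k) M) κ) = kingPr L k m M x := by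
  have hℓ0 : 0 < L ^ m := pow_pos (Nat.pos_of_ne_zero (NeZero.ne L)) m
  rw [← linePt_pred_eq_sub_unitVec M (L ^ m * L ^ k) κ x h]
  exact kingPr_linePt M L k m κ x (lt_of_le_of_lt (Nat.sub_le _ _) (cellOff_lt M _ hℓ0 x κ))

end Cells

/-! ## §2 Line means and line antiderivatives -/

section Lines

variable (M : Fin (d + 1) → ℕ) [∀ μ, NeZero (M μ)] (n : ℕ) [NeZero n] (ℓ : ℕ)

/-- **THE LINE MEAN** over the `κ`-line of the cell: `(lineMean g)(x, a) = ℓ⁻¹·Σ_{j<ℓ} g(linePt κ x j, a)` (the passive bond index `a` is kept). [folklore] -/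
noncomputable def lineMean (κ : Fin (d + 1)) : (Tor (fine n M) × Fin (d + 1) → ℝ) →ₗ[ℝ] (Tor (fine n M) × Fin (d + 1) → ℝ) where
  toFun g := fun z => (ℓ : ℝ)⁻¹ * ∑ j ∈ range ℓ, g (linePt M n ℓ κ z.1 j, z.2)
  map_add' g g' := by funext z; simp only [Pi.add_apply, sum_add_distrib, mul_add]
  map_smul' c g := by funext z; simp only [Pi.smul_apply, smul_eq_mul, RingHom.id_apply, ← mul_sum]; ring

/-- **THE LINE ANTIDERIVATIVE** from the cell's lower `κ`-face, with the lattice factor `n⁻¹ = η`: `(linePrim g)(x, a) = n⁻¹·Σ_{j ≤ off_κ x} g(linePt κ x j, a)`. [folklore] -/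
noncomputable def linePrim (κ : Fin (d + 1)) : (Tor (fine n M) × Fin (d + 1) → ℝ) →ₗ[ℝ] (Tor (fine n M) × Fin (d + 1) → ℝ) where
  toFun g := fun z => (n : ℝ)⁻¹ * ∑ j ∈ range (cellOff M n ℓ z.1 κ + 1), g (linePt M n ℓ κ z.1 j, z.2)
  map_add' g g' := by funext z; simp only [Pi.add_apply, sum_add_distrib, mul_add]
  map_smul' c g := by funext z; simp only [Pi.smul_apply, smul_eq_mul, RingHom.id_apply, ← mul_sum]; ring

variable {ℓ}

omit [∀ μ, NeZero (M μ)] [NeZero n] in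
/-- pointwise form of the line mean. [folklore] -/
theorem lineMean_apply (κ : Fin (d + 1)) (g : Tor (fine n M) × Fin (d + 1) → ℝ) (z : Tor (fine n M) × Fin (d + 1)) :
    lineMean M n ℓ κ g z = (ℓ : ℝ)⁻¹ * ∑ j ∈ range ℓ, g (linePt M n ℓ κ z.1 j, z.2) := rfl

omit [∀ μ, NeZero (M μ)] [NeZero n] in
/-- pointwise form of the line antiderivative. [folklore] -/
theorem linePrim_apply (κ : Fin (d + 1)) (g : Tor (fine n M) × Fin (d + 1) → ℝ) (z : Tor (fine n M) × Fin (d + 1)) :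
    linePrim M n ℓ κ g z = (n : ℝ)⁻¹ * ∑ j ∈ range (cellOff M n ℓ z.1 κ + 1), g (linePt M n ℓ κ z.1 j, z.2) := rfl

/-- the line mean is CONSTANT ON LINES: `(lineMean g)(linePt κ x j, a) = (lineMean g)(x, a)` (`j < ℓ`). [folklore] -/
theorem lineMean_linePt (hℓn : ℓ ∣ n) (κ : Fin (d + 1)) (g : Tor (fine n M) × Fin (d + 1) → ℝ) (x : Tor (fine n M)) {j : ℕ} (hj : j < ℓ) (a : Fin (d + 1)) :
    lineMean M n ℓ κ g (linePt M n ℓ κ x j, a) = lineMean M n ℓ κ g (x, a) := by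
  simp only [lineMean_apply, linePt_linePt M n hℓn κ x hj]

/-- the line mean is IDEMPOTENT. [folklore] -/
theorem lineMean_lineMean (hℓn : ℓ ∣ n) (κ : Fin (d + 1)) (g : Tor (fine n M) × Fin (d + 1) → ℝ) :
    lineMean M n ℓ κ (lineMean M n ℓ κ g) = lineMean M n ℓ κ g := by
  have hℓ0 : 0 < ℓ := Nat.pos_of_dvd_of_pos hℓn (Nat.pos_of_ne_zero (NeZero.ne n))
  have hℓr : (ℓ : ℝ) ≠ 0 := Nat.cast_ne_zero.mpr hℓ0.ne'
  funext z
  rw [lineMean_apply, sum_congr rfl fun j hj => lineMean_linePt M n hℓn κ g z.1 (mem_range.mp hj) z.2, sum_const, card_range, nsmul_eq_mul,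
    ← mul_assoc, inv_mul_cancel₀ hℓr, one_mul]

omit [∀ μ, NeZero (M μ)] [NeZero n] in
/-- the line mean of a function bounded by `C` on the line is bounded by `C`. [folklore] -/
theorem abs_lineMean_le (hℓ : 0 < ℓ) (κ : Fin (d + 1)) {g : Tor (fine n M) × Fin (d + 1) → ℝ} {z : Tor (fine n M) × Fin (d + 1)} {C : ℝ}
    (hg : ∀ j < ℓ, |g (linePt M n ℓ κ z.1 j, z.2)| ≤ C) : |lineMean M n ℓ κ g z| ≤ C := by
  have hℓr : (0 : ℝ) < ℓ := Nat.cast_pos.mpr hℓ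
  rw [lineMean_apply, abs_mul, abs_inv, abs_of_pos hℓr, inv_mul_le_iff₀ hℓr]
  calc |∑ j ∈ range ℓ, g (linePt M n ℓ κ z.1 j, z.2)| ≤ ∑ j ∈ range ℓ, |g (linePt M n ℓ κ z.1 j, z.2)| := abs_sum_le_sum_abs _ _
    _ ≤ ∑ _j ∈ range ℓ, C := sum_le_sum fun j hj => hg j (mem_range.mp hj)
    _ = ℓ * C := by rw [sum_const, card_range, nsmul_eq_mul]

omit [∀ μ, NeZero (M μ)] in
/-- ★ **THE RATE**: the line antiderivative of a function bounded by `C ≥ 0` on the line is bounded by `(ℓ∕n)·C` — `(ℓ∕n) = L^{−k}` at `n = L^mL^k`, `ℓ = L^m`. [folklore] -/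
theorem abs_linePrim_le (hℓ : 0 < ℓ) (κ : Fin (d + 1)) {g : Tor (fine n M) × Fin (d + 1) → ℝ} {z : Tor (fine n M) × Fin (d + 1)} {C : ℝ} (hC : 0 ≤ C)
    (hg : ∀ j < ℓ, |g (linePt M n ℓ κ z.1 j, z.2)| ≤ C) : |linePrim M n ℓ κ g z| ≤ (ℓ : ℝ) / n * C := by
  have hnr : (0 : ℝ) < n := Nat.cast_pos.mpr (Nat.pos_of_ne_zero (NeZero.ne n))
  have hr : cellOff M n ℓ z.1 κ + 1 ≤ ℓ := cellOff_lt M n hℓ z.1 κ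
  rw [linePrim_apply, abs_mul, abs_inv, abs_of_pos hnr, div_mul_eq_mul_div, le_div_iff₀ hnr, mul_comm, ← mul_assoc, mul_inv_cancel₀ hnr.ne', one_mul]
  calc |∑ j ∈ range (cellOff M n ℓ z.1 κ + 1), g (linePt M n ℓ κ z.1 j, z.2)| ≤ ∑ j ∈ range (cellOff M n ℓ z.1 κ + 1), |g (linePt M n ℓ κ z.1 j, z.2)| :=
        abs_sum_le_sum_abs _ _
    _ ≤ ∑ _j ∈ range (cellOff M n ℓ z.1 κ + 1), C := sum_le_sum fun j hj => hg j (lt_of_lt_of_le (mem_range.mp hj) hr)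
    _ = (cellOff M n ℓ z.1 κ + 1 : ℕ) * C := by rw [sum_const, card_range, nsmul_eq_mul]
    _ ≤ ℓ * C := mul_le_mul_of_nonneg_right (by exact_mod_cast hr) hC

/-- the line antiderivative AT THE LOWER FACE is `n⁻¹·g`. [folklore] -/
theorem linePrim_apply_of_cellOff_eq_zero (κ : Fin (d + 1)) (g : Tor (fine n M) × Fin (d + 1) → ℝ) {z : Tor (fine n M) × Fin (d + 1)} (h : cellOff M n ℓ z.1 κ = 0) :
    linePrim M n ℓ κ g z = (n : ℝ)⁻¹ * g z := by
  rw [linePrim_apply, h, zero_add, sum_range_one, ← h, linePt_cellOff]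

/-- the line antiderivative ONE STEP BACK INSIDE THE CELL loses the last term: `(linePrim g)(x − e_κ) = (linePrim g)(x) − n⁻¹·g(x)` (`off_κ x ≠ 0`, `ℓ ∣ n`). [folklore] -/
theorem linePrim_sub_unitVec_of_ne_zero (hℓn : ℓ ∣ n) (κ : Fin (d + 1)) (g : Tor (fine n M) × Fin (d + 1) → ℝ) {z : Tor (fine n M) × Fin (d + 1)}
    (h : cellOff M n ℓ z.1 κ ≠ 0) : linePrim M n ℓ κ g (z.1 - unitVec (fine n M) κ, z.2) = linePrim M n ℓ κ g z - (n : ℝ)⁻¹ * g z := by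
  have hℓ0 : 0 < ℓ := Nat.pos_of_dvd_of_pos hℓn (Nat.pos_of_ne_zero (NeZero.ne n))
  have hr1 : cellOff M n ℓ z.1 κ - 1 < ℓ := lt_of_le_of_lt (Nat.sub_le _ _) (cellOff_lt M n hℓ0 z.1 κ)
  have hpt : z.1 - unitVec (fine n M) κ = linePt M n ℓ κ z.1 (cellOff M n ℓ z.1 κ - 1) := (linePt_pred_eq_sub_unitVec M n κ z.1 h).symm
  rw [linePrim_apply, linePrim_apply, hpt, cellOff_linePt_self M n hℓn κ z.1 hr1, Nat.sub_add_cancel (Nat.one_le_iff_ne_zero.mpr h)]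
  simp only [linePt_linePt M n hℓn κ z.1 hr1]
  conv_rhs => rw [sum_range_succ, linePt_cellOff]
  ring

/-- the line antiderivative ONE STEP BACK ACROSS THE FACE is the full line sum of the previous cell: `(linePrim g)(x − e_κ) = (ℓ∕n)·(lineMean g)(x − e_κ)` (`off_κ x = 0`). [folklore] -/
theorem linePrim_sub_unitVec_of_eq_zero (hℓn : ℓ ∣ n) (κ : Fin (d + 1)) (g : Tor (fine n M) × Fin (d + 1) → ℝ) {z : Tor (fine n M) × Fin (d + 1)}
    (h : cellOff M n ℓ z.1 κ = 0) : linePrim M n ℓ κ g (z.1 - unitVec (fine n M) κ, z.2) = (ℓ : ℝ) / n * lineMean M n ℓ κ g (z.1 - unitVec (fine n M) κ, z.2) := by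
  have hℓ0 : 0 < ℓ := Nat.pos_of_dvd_of_pos hℓn (Nat.pos_of_ne_zero (NeZero.ne n))
  have hℓr : (ℓ : ℝ) ≠ 0 := Nat.cast_ne_zero.mpr hℓ0.ne'
  rw [linePrim_apply, lineMean_apply, cellOff_sub_unitVec_of_eq_zero M n hℓn κ z.1 h, Nat.sub_add_cancel hℓ0, ← mul_assoc,
    show (ℓ : ℝ) / n * (ℓ : ℝ)⁻¹ = (n : ℝ)⁻¹ by field_simp]

end Lines

/-! ## §3 ★ The divergence form: `∇*_κ ∘ linePrim_κ = −1 + (face term)`, and the same behind `M_{·} ∘ P` -/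

section Divergence

variable (M : Fin (d + 1) → ℕ) [∀ μ, NeZero (M μ)] (n : ℕ) [NeZero n] {ℓ : ℕ}

/-- ★ **`∇*_κ(linePrim_κ g) = −g + 1_{off_κ = 0}·ℓ·(lineMean_κ g)(· − e_κ)`** (`ℓ ∣ n`): inside the cell the backward quotient of the antiderivative returns `−g`; at a lower face
it also sees the FULL line sum of the previous cell. [folklore] -/
theorem divAdj_linePrim_apply (hℓn : ℓ ∣ n) (κ : Fin (d + 1)) (g : Tor (fine n M) × Fin (d + 1) → ℝ) (z : Tor (fine n M) × Fin (d + 1)) :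
    symbOp M n ((n : ℝ) • (sTinv M n κ - 1)) (linePrim M n ℓ κ g) z =
      -g z + (if cellOff M n ℓ z.1 κ = 0 then (ℓ : ℝ) * lineMean M n ℓ κ g (z.1 - unitVec (fine n M) κ, z.2) else 0) := by
  have hnr : (n : ℝ) ≠ 0 := Nat.cast_ne_zero.mpr (NeZero.ne n)
  rw [symbOp_divAdj_apply]
  split_ifs with h
  · rw [linePrim_sub_unitVec_of_eq_zero M n hℓn κ g h, linePrim_apply_of_cellOff_eq_zero M n κ g h]
    field_simp
    ring
  · rw [linePrim_sub_unitVec_of_ne_zero M n hℓn κ g h]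
    field_simp
    ring

/-- ONE GRID: a function with ZERO `κ`-line means is minus the backward quotient of its line antiderivative, `g = −∇*_κ(linePrim_κ g)`. [folklore] -/
theorem eq_neg_divAdj_linePrim_of_lineMean (hℓn : ℓ ∣ n) (κ : Fin (d + 1)) {g : Tor (fine n M) × Fin (d + 1) → ℝ} (hg : lineMean M n ℓ κ g = 0) :
    g = -symbOp M n ((n : ℝ) • (sTinv M n κ - 1)) (linePrim M n ℓ κ g) := by
  funext z
  rw [Pi.neg_apply, divAdj_linePrim_apply M n hℓn, hg]
  simp

variable (L k m : ℕ) [NeZero L]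

/-- ★★ **THE SAME BEHIND `M_{·} ∘ P`** (`P = pull (kingPrV L k m M)`, `n′ = L^mL^k`, cells of side `L^m` = the pairing's fibres):
`∇′*_κ(linePrim_κ g · Pφ)(x′) = −g(x′)φ(πx′) + 1_{off_κ x′ = 0}·L^m·(lineMean_κ g)(x′ − e′_κ)·φ(π(x′ − e′_κ))` — inside the cell `π(x′ − e′_κ) = π x′`. [cite: King1986, p.664 (pairing convention «x′ ∈ B^n(x)»)] -/
theorem divAdj_mulOp_linePrim_pull_apply (κ : Fin (d + 1)) (g : Tor (fine (L ^ m * L ^ k) M) × Fin (d + 1) → ℝ) (φ : Tor (fine (L ^ k) M) × Fin (d + 1) → ℝ)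
    (z : Tor (fine (L ^ m * L ^ k) M) × Fin (d + 1)) :
    symbOp M (L ^ m * L ^ k) (((L ^ m * L ^ k : ℕ) : ℝ) • (sTinv M (L ^ m * L ^ k) κ - 1))
        (mulOp (linePrim M (L ^ m * L ^ k) (L ^ m) κ g) (pull (kingPrV L k m M) φ)) z =
      -(g z * φ (kingPrV L k m M z)) + (if cellOff M (L ^ m * L ^ k) (L ^ m) z.1 κ = 0 then
        ((L ^ m : ℕ) : ℝ) * lineMean M (L ^ m * L ^ k) (L ^ m) κ g (z.1 - unitVec (fine (L ^ m * L ^ k) M) κ, z.2) *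
          φ (kingPrV L k m M (z.1 - unitVec (fine (L ^ m * L ^ k) M) κ, z.2)) else 0) := by
  have hℓn : L ^ m ∣ L ^ m * L ^ k := Dvd.intro _ rfl
  have hnr : ((L ^ m * L ^ k : ℕ) : ℝ) ≠ 0 := Nat.cast_ne_zero.mpr (NeZero.ne _)
  rw [symbOp_divAdj_apply, mulOp_apply, mulOp_apply, pull_apply, pull_apply]
  split_ifs with h
  · rw [linePrim_sub_unitVec_of_eq_zero M _ hℓn κ g h, linePrim_apply_of_cellOff_eq_zero M _ κ g h]
    have key : ∀ A B C D : ℝ, ((L ^ m * L ^ k : ℕ) : ℝ) * (((L ^ m : ℕ) : ℝ) / ((L ^ m * L ^ k : ℕ) : ℝ) * A * B - ((L ^ m * L ^ k : ℕ) : ℝ)⁻¹ * C * D) =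
        ((L ^ m : ℕ) : ℝ) * A * B - C * D := fun A B C D => by field_simp
    rw [key]
    ring
  · rw [linePrim_sub_unitVec_of_ne_zero M _ hℓn κ g h, kingPrV_eq, kingPrV_eq, kingPr_sub_unitVec_of_ne_zero M L k m κ z.1 h]
    have key : ∀ A B C : ℝ, ((L ^ m * L ^ k : ℕ) : ℝ) * ((A - ((L ^ m * L ^ k : ℕ) : ℝ)⁻¹ * C) * B - A * B) = -(C * B) := fun A B C => by field_simp; ring
    rw [key]
    simp

/-- ★★★ **A `κ`-LINE-MEAN-ZERO MULTIPLIER BEHIND KING's PROLONGATION IS AN EXACT FINE DIVERGENCE**: `lineMean_κ g = 0 ⟹ M_g ∘ P = −∇′*_κ ∘ M_{linePrim_κ g} ∘ P` — the face term dies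
with the previous cell's line sum; `|linePrim_κ g| ≤ L^{−k}·sup|g|` (`abs_linePrim_le`). [folklore] -/
theorem mulOp_comp_pull_eq_neg_divAdj_of_lineMean (κ : Fin (d + 1)) {g : Tor (fine (L ^ m * L ^ k) M) × Fin (d + 1) → ℝ}
    (hg : lineMean M (L ^ m * L ^ k) (L ^ m) κ g = 0) :
    mulOp g ∘ₗ pull (kingPrV L k m M) =
      -(symbOp M (L ^ m * L ^ k) (((L ^ m * L ^ k : ℕ) : ℝ) • (sTinv M (L ^ m * L ^ k) κ - 1)) ∘ₗ
        (mulOp (linePrim M (L ^ m * L ^ k) (L ^ m) κ g) ∘ₗ pull (kingPrV L k m M))) := by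
  refine LinearMap.ext fun φ => funext fun z => ?_
  rw [LinearMap.neg_apply, Pi.neg_apply, LinearMap.comp_apply, LinearMap.comp_apply, LinearMap.comp_apply, divAdj_mulOp_linePrim_pull_apply, hg]
  simp [mulOp_apply, pull_apply]

end Divergence

end Summit.QuantumFields.YangMills.BalabanUVNodes.N15.TwoGrid
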